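import Literature.AlgebraicGeometry.HodgeTheory.RealCharactersSp6SlotsHodgeClasses
import HarnessLib

/-!
# Real `𝔰𝔭₆`-block data on `H¹` of an abelian variety with commutative `End⁰` (Ribet 1983 Thm. 1 in relative dimension three, in the form stable under orthogonal products): `B = D` for everything with slots over a carrier, condition (D), the Hodge conjecture for all powers; the real-multiplication instance `End⁰A = F` totally real with `dim A = 3[F:ℚ]`; orthogonal products

Family `hodge`, layer `Literature/AlgebraicGeometry/HodgeTheory`. Research context: cell `pub-hodge-ring2`
(HONEST FRAMING: research route conditional on HC_CM; not a corollary; Q11.4-sentence-2 already refuted in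
dim ≥ 3), Literature lane gen 82, programme R59 «Ribet 1983 in relative dimension three», the ABELIAN-VARIETY ASSEMBLY.
UNCONDITIONAL; ONE definition (`HasRealSp6Blocks`, a `Prop`-valued predicate WITH BODY — not a named fact); no named
fact; no `sorry`; no step towards a summit statement beyond the published theorems it assembles. The rank-six twin of the
tree's `RealSp4Blocks` (Moonen–Zarhin 1995 Type I(2)), line by line, fed by `RealCharactersSp6SlotsHodgeClasses`
(`AVSlots.isDivisorGenerated_of_sp6BlockBasis`, Hodge–Darboux six-block bases and their symplectic classes) and, through it,
by the rank-six Lie theorems `SpBlocksThetaSix.*` (where the E³-type skeleton of Moonen–Zarhin 1999 (2.5) is excluded).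

THE PRINTED THEOREM. K. A. Ribet, Amer. J. Math. 105 (1983), Thm. 1 (Gordon's survey Thm. 6.3, p. 18): «suppose `End⁰A`
is a totally real field of degree `e` over `ℚ`, and `d/e` is odd … Then `Hg(A) = Lf(A)` and thus `Hdg(Aⁿ) = Div(Aⁿ)` for
`n ≥ 1`.» This file proves the case `d/e = 3` (`hasRealSp6Blocks_of_isTotallyReal_of_three_mul_finrank_eq` with
`HasRealSp6Blocks.isDivisorGenerated_powSucc`), hence the Hodge conjecture for all powers of such `A`
(`HasRealSp6Blocks.hodgeConjectureFor_powSucc`; every Hodge class is a combination of products of divisor classes, which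
are algebraic by Lefschetz (1,1)), and condition (D) (`IsStablyNondegenerate`) — the `d = 3` slice of the tree's named fact
`Ribet1983_hodgeClasses_divisorial_powers_totallyRealField_oddRelDim`, now a theorem (the cases `d/e = 1` and the even
case `d/e = 2` are the tree's `RealSl2Blocks` and `RealSp4Blocks`).

* §1 `HasRealSp6Blocks` and its consequences: **`HasRealSp6Blocks.isDivisorGenerated_of_avSlots`** (`B• = D• ⊗ ℂ` for every
  `B` with slots over `A`), `…isDivisorGenerated_powSucc`, **`…isStablyNondegenerate`** (condition (D)),
  **`…hodgeConjectureFor_powSucc`**, `…hodgeConjectureFor_of_isIsogenous_powSucc`, `…hasNoTypeIVFactor`.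
* §2 **`hasRealSp6Blocks_of_isTotallyReal_of_three_mul_finrank_eq`** — `End⁰(A) = F` a totally real field with
  `3[F:ℚ] = dim A` is a carrier (`finrank_eigenBlock_hodgeCharacter_eq_six`); isogeny closure.
* §3 **`HasRealSp6Blocks.prod`** — carriers are stable under orthogonal products (`Hom(A, B) = 0 = Hom(B, A)`), hence
  `B•((A × B)ⁿ) = D•`, condition (D) for `A × B`, the Hodge conjecture for every `(A × B)^{N+1}`, every `A^{M+1} × B^{N+1}`
  and everything isogenous to one — unconditionally for two orthogonal relative-dimension-three real-multiplication
  varieties (Moonen–Zarhin 1999 Thm. (3.2)(1) = Hazama 1989 on this class). (Mixed products of an `𝔰𝔭₄`- and an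
  `𝔰𝔭₆`-carrier are not treated here.)

## References

* [Ribet1983] K. A. Ribet, *Hodge classes on certain types of abelian varieties*, Amer. J. Math. 105 (1983), Thms. 0, 1.
  [cite: Ribet1983, Thm. 1]
* [Gordon1997] B. B. Gordon, arXiv:alg-geom/9709030, Thms. 6.2–6.3, p. 18. [cite: Gordon1997, Thm. 6.3 (arXiv:alg-geom/9709030 p. 18)]
* [Murty1984] V. K. Murty, Math. Ann. 268 (1984), §3. [cite: Murty1984, §3]
* [Hazama1983] F. Hazama, Tôhoku Math. J. 35 (1983), §3. [cite: Hazama1983, §3 (pp. 305–306)]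
* [Hazama1989] F. Hazama, Duke Math. J. 58 (1989) 31–37. [cite: Hazama1989, Thm. (= Gordon 7.6.2)]
* [MoonenZarhin1999LowDim] B. Moonen, Yu. Zarhin, Math. Ann. 315 (1999), §1, §3 Thm. (3.2)(1). [cite: MoonenZarhin1999LowDim, §3 Thm. (3.2)(1)]
* [Gordon1999HodgeAVSurvey] B. B. Gordon, survey, Thm. 7.5, Def. 7.6. [cite: Gordon1999HodgeAVSurvey, Thm. 7.5 (1) and Def. 7.6]
* [Lange2023AbelianVarietiesC] H. Lange, *Abelian Varieties over the Complex Numbers* (2023), Prop. 1.1.8, Cor. 2.4.26.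
  [cite: Lange2023AbelianVarietiesC, Prop. 1.1.8 and Cor. 2.4.26]
* [Milne1986AbelianVarieties] J. S. Milne, *Abelian varieties* (1986), §12 p. 122. [cite: Milne1986AbelianVarieties, §12 p. 122]
* [vanGeemen1994HodgeAV] B. van Geemen, Lemma 3.7. [cite: vanGeemen1994HodgeAV, Lemma 3.7]
-/

noncomputable section

open scoped TensorProduct
open CategoryTheory Module NumberField

namespace Literature.AlgebraicGeometry.HodgeTheory

open Literature.AlgebraicTopology.SingularHomology
open Literature.AlgebraicGeometry.Motives (IsSmoothProjective AbelianVariety bettiCohomology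
  ofRatClassBaseChange ofRatClassBaseChange_tmul HodgeTensorFacts hodgeTensorFacts_holds)
open Literature.Barriers.HodgeConjecture
open Literature.AlgebraicGeometry.Motives.HodgeStructure
open Literature.AlgebraicGeometry.ComplexMultiplication
open Literature.RepresentationTheory.GeneralLinear
open Literature.NumberTheory.DiophantineGeometry

/-! ### §1 The notion and its consequences -/

section Data

variable {A B : AbelianVariety ℂ} {n : ℕ} {g : Fin n → (B ⟶ A)}

/-- **Real `𝔰𝔭₆`-block data on `H¹(A)`** (the abstract input of Ribet's argument for `d/e = 3`, in the form stable under
orthogonal products): `End⁰(A)` is commutative, and there are finitely many characters `τ_i : End⁰(A) → ℂ`, all REAL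
(`conj ∘ τ_i = τ_i`), whose joint eigenspaces `V_i = ⋂_e ker(e^* ⊗ ℂ − τ_i(e))` on `H¹(A(ℂ); ℚ) ⊗ ℂ` form an internal
direct sum with `dim_ℂ V_i = 6` («`H¹(A, ℂ) = V₁ ⊕ ⋯ ⊕ V_k`», Hazama p. 305; «`W ⊗ ℂ ≃ ⊕_σ U_σ`, `U_σ` of dimension
`r = 2 dim A/[K:ℚ]`», Gordon p. 18, here `r = 6`). The rank-six twin of the tree's `HasRealSl2Blocks` / `HasRealSp4Blocks`.
[cite: Ribet1983, Thm. 1] [cite: Gordon1997, Thm. 6.3 (arXiv:alg-geom/9709030 p. 18)] [cite: Hazama1983, §3 (pp. 305–306)] -/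
def HasRealSp6Blocks (A : AbelianVariety ℂ) : Prop :=
  (∀ x y : A.endAlgebra, x * y = y * x) ∧
  ∃ (ι : Type) (_ : Fintype ι) (_ : DecidableEq ι) (τ : ι → (A.endAlgebra →+* ℂ)),
    (∀ i, (starRingEnd ℂ).comp (τ i) = τ i) ∧
    DirectSum.IsInternal (fun i => (⨅ e : A.endAlgebra,
      Module.End.eigenspace ((MulOpposite.unop (bettiRep A e)).baseChange ℂ) (τ i e) : Submodule ℂ _)) ∧
    ∀ i, Module.finrank ℂ (⨅ e : A.endAlgebra,
      Module.End.eigenspace ((MulOpposite.unop (bettiRep A e)).baseChange ℂ) (τ i e) : Submodule ℂ _) = 6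

/-- `End⁰(A)` is commutative when `A` has real `𝔰𝔭₆`-block data. [cite: Hazama1983, §3 (pp. 305–306)] -/
theorem HasRealSp6Blocks.comm (h : HasRealSp6Blocks A) : ∀ x y : A.endAlgebra, x * y = y * x := h.1

/-- Distinct blocks of an internal direct sum with non-zero blocks have distinct characters. [folklore] -/
private theorem injective_of_isInternal_eigenBlock_six {V : Type} [AddCommGroup V] [Module ℚ V] {m : ℕ}
    (H : Literature.AlgebraicGeometry.Motives.HodgeStructure V m) {ι : Type} [DecidableEq ι] (σ : ι → (H.endAlg →+* ℂ))
    (hint : DirectSum.IsInternal fun i => H.eigenBlock (σ i))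
    (h6 : ∀ i, Module.finrank ℂ (H.eigenBlock (σ i)) = 6) : Function.Injective σ := by
  intro k k' hkk'
  by_contra hne
  have hbot : H.eigenBlock (σ k) = ⊥ := by
    have h := hint.submodule_iSupIndep.pairwiseDisjoint hne
    change Disjoint (H.eigenBlock (σ k)) (H.eigenBlock (σ k')) at h
    rw [← hkk'] at h
    exact disjoint_self.1 h
  have h0 := h6 k
  rw [hbot, finrank_bot] at h0
  exact absurd h0 (by norm_num)

/-- **`B• = D• ⊗ ℂ` for every abelian variety with slots over an `A` with real `𝔰𝔭₆`-block data** (Riemann +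
automatic self-adjointness + Hodge–Darboux block bases + the symplectic classes of §1 + the invariance theorem and the
coloured symplectic first fundamental theorem, `AVSlots.isDivisorGenerated_of_sp6BlockBasis` of `RealCharactersSp6SlotsHodgeClasses`).
[cite: Ribet1983, Thm. 1] [cite: Gordon1997, Thm. 6.3 (arXiv:alg-geom/9709030 p. 18)] [cite: Murty1984, §3]
[cite: MoonenZarhin1999LowDim, §3 Thm. (3.2)(1)] -/
theorem HasRealSp6Blocks.isDivisorGenerated_of_avSlots (h : HasRealSp6Blocks A) (hg : AVSlots A B g) :
    IsDivisorGenerated B := by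
  classical
  obtain ⟨hc, ι, _, _, τ, hreal, hint, h6⟩ := h
  have hHD : exists_isReal_hodgeModel := exists_isReal_hodgeModel_holds
  have hI : hodgePQ_independent_of_hodgeModel := hodgePQ_independent_of_hodgeModel_holds
  haveI : HodgeTensorFacts.{0, 0} := hodgeTensorFacts_holds.{0, 0}
  haveI : Module.Finite ℚ (bettiCohomology A.X 1) := finite_bettiCohomology_one A
  have hX : IsSmoothProjective A.dim A.X := AbelianVariety.isSmoothProjective_holds
  obtain ⟨ψ⟩ : (BettiUniverse.hodge hHD (AbelianVariety.isSmoothProjective_holds (A := A)) 1).IsPolarizable :=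
    smoothProjective_hodgeStructure_isPolarizable_holds hX (BettiUniverse.realHodgeModel hHD hX)
      (BettiUniverse.realHodgeModel_isHodgeSymmetric hHD hX) 1
  have heff : (BettiUniverse.hodge hHD hX 1).IsEffective := BettiUniverse.hodge_isEffective hHD hX 1
  -- the characters of `End_Hdg`
  set Φ := endAlgebraAlgEquivEndAlgOfComm hc hHD hI with hΦ
  have heq : ∀ i, (BettiUniverse.hodge hHD (AbelianVariety.isSmoothProjective_holds (A := A)) 1).eigenBlock
      ((τ i).comp Φ.symm.toRingEquiv.toRingHom) =
      ⨅ e : A.endAlgebra, Module.End.eigenspace ((MulOpposite.unop (bettiRep A e)).baseChange ℂ) (τ i e) :=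
    fun i => eigenBlock_comp_endAlgebraAlgEquivEndAlgOfComm_symm hc hHD hI (τ i)
  have hreal' : ∀ i, (starRingEnd ℂ).comp ((τ i).comp Φ.symm.toRingEquiv.toRingHom) =
      (τ i).comp Φ.symm.toRingEquiv.toRingHom :=
    fun i => comp_endAlgebraAlgEquivEndAlgOfComm_symm_isReal hc hHD hI (hreal i)
  have hfun : (fun i => (BettiUniverse.hodge hHD (AbelianVariety.isSmoothProjective_holds (A := A)) 1).eigenBlock
      ((τ i).comp Φ.symm.toRingEquiv.toRingHom)) = fun i => (⨅ e : A.endAlgebra,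
        Module.End.eigenspace ((MulOpposite.unop (bettiRep A e)).baseChange ℂ) (τ i e) : Submodule ℂ _) :=
    funext heq
  have hint' : DirectSum.IsInternal fun i =>
      (BettiUniverse.hodge hHD (AbelianVariety.isSmoothProjective_holds (A := A)) 1).eigenBlock
        ((τ i).comp Φ.symm.toRingEquiv.toRingHom) := by
    rw [hfun]; exact hint
  have h6' : ∀ i, Module.finrank ℂ
      ((BettiUniverse.hodge hHD (AbelianVariety.isSmoothProjective_holds (A := A)) 1).eigenBlock
        ((τ i).comp Φ.symm.toRingEquiv.toRingHom)) = 6 := fun i => by rw [heq]; exact h6 i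
  have hself := isAdjointPair_self_of_real_characters
    (BettiUniverse.hodge hHD (AbelianVariety.isSmoothProjective_holds (A := A)) 1) (by norm_num)
    (BettiUniverse.hodge_isEffective hHD hX 1) ψ _ hreal' hint'
  have hσ := injective_of_isInternal_eigenBlock_six (BettiUniverse.hodge hHD (AbelianVariety.isSmoothProjective_holds (A := A)) 1) _ hint' h6'
  -- Hodge–Darboux block bases and their symplectic classes
  obtain ⟨b, hbP, hbQ, hgram⟩ :=
    exists_hodgeDarboux_blockBasis_six (BettiUniverse.hodge hHD hX 1) Nat.cast_one heff ψ hself _ hint' h6'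
  have hθ := thetaSix_mem_span_rational_oneOne_of_characters hHD hI ψ hself _ hσ hint' b hbP hbQ hgram
  exact hg.isDivisorGenerated_of_sp6BlockBasis hHD hI ψ hself _ hreal' hint' h6' b hbP hbQ hgram hθ

/-- **`B•(A^{N+1}) = D•(A^{N+1}) ⊗ ℂ` for all `N`** («`Hdg(Aⁿ) = Div(Aⁿ)` for `n ≥ 1`»). [cite: Ribet1983, Thm. 1] [cite: Gordon1997, Thm. 6.3 (arXiv:alg-geom/9709030 p. 18)] -/
theorem HasRealSp6Blocks.isDivisorGenerated_powSucc (h : HasRealSp6Blocks A) (N : ℕ) :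
    IsDivisorGenerated (A.powSucc N) :=
  h.isDivisorGenerated_of_avSlots (AVSlots.powSucc A N)

/-- **Condition (D)**: `A` is stably nondegenerate. [cite: MoonenZarhin1999LowDim, §3 Thm. (3.2)(1)]
[cite: Gordon1999HodgeAVSurvey, Thm. 7.5 (1) and Def. 7.6] -/
theorem HasRealSp6Blocks.isStablyNondegenerate (h : HasRealSp6Blocks A) : IsStablyNondegenerate A :=
  (isStablyNondegenerate_iff A).2 h.isDivisorGenerated_powSucc

/-- **The Hodge conjecture for every power `A^{N+1}`**, unconditionally. [cite: Ribet1983, Thm. 1]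
[cite: MoonenZarhin1999LowDim, §3 Thm. (3.2)(1)] -/
theorem HasRealSp6Blocks.hodgeConjectureFor_powSucc (h : HasRealSp6Blocks A) (N : ℕ) :
    HodgeConjectureFor (A.powSucc N).dim (A.powSucc N).X :=
  hodgeConjectureFor_of_isDivisorGenerated _ (h.isDivisorGenerated_powSucc N)

/-- The Hodge conjecture for everything isogenous to a power of `A`. [cite: vanGeemen1994HodgeAV, Lemma 3.7] -/
theorem HasRealSp6Blocks.hodgeConjectureFor_of_isIsogenous_powSucc (h : HasRealSp6Blocks A)
    {X : AbelianVariety ℂ} {N : ℕ} (hX : X.IsIsogenous (A.powSucc N)) : HodgeConjectureFor X.dim X.X :=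
  HodgeConjectureFor.of_isIsogenous hX (h.hodgeConjectureFor_powSucc N)

/-- **A carrier of real `𝔰𝔭₆`-block data has no factor of type IV** (verbatim `HasRealSp4Blocks.hasNoTypeIVFactor`:
every complex root of the characteristic polynomial of `z^*` is one of the real scalars `τ_i(z)`).
[cite: MoonenZarhin1999LowDim, §1] [cite: Hazama1983, §3 (pp. 305–306)] [cite: Lange2023AbelianVarietiesC, Prop. 1.1.8 and Cor. 2.4.26] -/
theorem HasRealSp6Blocks.hasNoTypeIVFactor (h : HasRealSp6Blocks A) : HasNoTypeIVFactor A := by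
  classical
  obtain ⟨hc, ι, _, _, τ, hreal, hint, -⟩ := h
  haveI : Module.Finite ℚ (bettiCohomology A.X 1) := finite_bettiCohomology_one A
  intro z _
  refine ⟨(MulOpposite.unop (bettiRep A z)).charpoly,
    (LinearMap.charpoly_monic (MulOpposite.unop (bettiRep A z))).ne_zero, ?_, fun x hx => ?_⟩
  · have hinj : Function.Injective (bettiRepOfComm A hc) := fun a b hab => by
      rw [bettiRepOfComm_apply, bettiRepOfComm_apply] at hab
      exact bettiRep_injective (MulOpposite.unop_injective hab)
    apply hinj
    rw [← Polynomial.aeval_algHom_apply, map_zero, bettiRepOfComm_apply]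
    exact LinearMap.aeval_self_charpoly _
  · have hx' : ((MulOpposite.unop (bettiRep A z)).baseChange ℂ).charpoly.IsRoot x := by
      rw [LinearMap.charpoly_baseChange, Polynomial.IsRoot.def, Polynomial.eval_map_algebraMap]
      exact hx
    obtain ⟨v, hv, hv0⟩ :=
      ((Module.End.hasEigenvalue_iff_isRoot_charpoly _ x).2 hx').exists_hasEigenvector
    by_contra hxim
    have hne : ∀ i, τ i z ≠ x := by
      intro i hi
      apply hxim
      rw [← hi]
      have h1 := RingHom.congr_fun (hreal i) z
      rw [RingHom.comp_apply] at h1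
      exact Complex.conj_eq_iff_im.1 h1
    have hle : ∀ i, (⨅ e : A.endAlgebra,
        Module.End.eigenspace ((MulOpposite.unop (bettiRep A e)).baseChange ℂ) (τ i e) : Submodule ℂ _) ≤
        ⨆ (μ : ℂ) (_ : μ ≠ x), Module.End.eigenspace ((MulOpposite.unop (bettiRep A z)).baseChange ℂ) μ :=
      fun i => (iInf_le _ z).trans
        (le_iSup₂_of_le (f := fun μ (_ : μ ≠ x) =>
          Module.End.eigenspace ((MulOpposite.unop (bettiRep A z)).baseChange ℂ) μ) (τ i z) (hne i) le_rfl)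
    have htop : (⊤ : Submodule ℂ (ℂ ⊗[ℚ] bettiCohomology A.X 1)) ≤
        ⨆ (μ : ℂ) (_ : μ ≠ x), Module.End.eigenspace ((MulOpposite.unop (bettiRep A z)).baseChange ℂ) μ := by
      rw [← hint.submodule_iSup_eq_top]
      exact iSup_le hle
    have hdis := Module.End.eigenspaces_iSupIndep ((MulOpposite.unop (bettiRep A z)).baseChange ℂ) x
    exact hv0 ((Submodule.disjoint_def.1 hdis) v hv (htop Submodule.mem_top))

end Data

/-! ### §2 The real-multiplication instance of relative dimension three (`End⁰A = F` totally real, `dim A = 3[F:ℚ]`) -/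

section RealMultiplication

variable {A : AbelianVariety ℂ}

/-- A number field has positive degree. [folklore] -/
private theorem finrank_pos_of_numberField₆ (E : Type*) [Field E] [NumberField E] :
    0 < Module.finrank ℚ E := Module.finrank_pos

/-- `0 < dim A` when `3[F:ℚ] = dim A` for the number field `F = End⁰(A)`. [folklore] -/
private theorem dim_pos_of_three_mul_finrank_eq₅ (hF : IsField A.endAlgebra)
    (hdeg : 3 * Module.finrank ℚ A.endAlgebra = A.dim) : 0 < A.dim := by
  have h := finrank_pos_of_numberField₆ (EndField A hF)
  rw [EndField.finrank_eq hF] at h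
  omega

/-- `[End⁰(A) : ℚ] > 0` for `End⁰(A)` a field. [folklore] -/
private theorem finrank_endAlgebra_pos_of_isField₆ (hF : IsField A.endAlgebra) : 0 < Module.finrank ℚ A.endAlgebra := by
  have h := finrank_pos_of_numberField₆ (EndField A hF)
  rw [EndField.finrank_eq hF] at h
  exact h

/-- **Each block `V_τ` is six-dimensional when `3[F : ℚ] = dim A`**: `dim_ℂ V_τ · [F:ℚ] = dim_ℚ H¹ = 2 dim A = 6[F:ℚ]`
(`EndAction.finrank_iInf_eigenspace_mul_finrank`, `finrank_bettiCohomology_one`); «`W ⊗ ℂ` is a free `K ⊗_ℚ ℂ`-module of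
rank `r = 2 dim A/[K:ℚ]`», Gordon p. 18, here `r = 6`. The tree's `finrank_eigenBlock_hodgeCharacter_eq_four` with `2 ↦ 3`.
[cite: Gordon1997, Thm. 6.3 (arXiv:alg-geom/9709030 p. 18)] [cite: Murty1984, §3] -/
theorem finrank_eigenBlock_hodgeCharacter_eq_six (hF : IsField A.endAlgebra) (hHD : exists_isReal_hodgeModel)
    (hI : hodgePQ_independent_of_hodgeModel) (hdeg : 3 * Module.finrank ℚ A.endAlgebra = A.dim)
    (τ : EndField A hF →+* ℂ) :
    Module.finrank ℂ
      ((BettiUniverse.hodge hHD (AbelianVariety.isSmoothProjective_holds (A := A)) 1).eigenBlock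
        (hodgeCharacter hF hHD hI τ)) = 6 := by
  haveI : FiniteDimensional ℚ (bettiCohomology A.X 1) := finite_bettiCohomology_one A
  rw [eigenBlock_hodgeCharacter]
  have h : Module.finrank ℂ ↥(⨅ e : EndField A hF, Module.End.eigenspace
      ((hOneAlgHom (EndField.toEndAlgebra hF).toRingHom e).baseChange ℂ) (τ e)) *
      Module.finrank ℚ (EndField A hF) = Module.finrank ℚ (bettiCohomology A.X 1) :=
    (hOneEndAction (EndField.toEndAlgebra hF).toRingHom hHD hI (A := A)).finrank_iInf_eigenspace_mul_finrank τ
  rw [finrank_bettiCohomology_one, EndField.finrank_eq, ← hdeg] at h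
  refine Nat.eq_of_mul_eq_mul_right (finrank_endAlgebra_pos_of_isField₆ hF) ?_
  rw [h]
  ring

/-- `dim V_τ = 6` in the `embCharacter` indexing, when `3[F:ℚ] = dim A`. [cite: Gordon1997, Thm. 6.3 (arXiv:alg-geom/9709030 p. 18)] -/
theorem finrank_iInf_eigenspace_embCharacter_eq_six (hF : IsField A.endAlgebra) (hHD : exists_isReal_hodgeModel)
    (hI : hodgePQ_independent_of_hodgeModel) [IsTotallyReal (EndField A hF)]
    (hdeg : 3 * Module.finrank ℚ A.endAlgebra = A.dim) (τ : EndField A hF →+* ℂ) :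
    Module.finrank ℂ
      (⨅ e : A.endAlgebra,
        Module.End.eigenspace ((MulOpposite.unop (bettiRep A e)).baseChange ℂ) (embCharacter hF τ e) :
        Submodule ℂ _) = 6 := by
  rw [iInf_eigenspace_embCharacter_eq hF hHD hI]
  exact finrank_eigenBlock_hodgeCharacter_eq_six hF hHD hI hdeg τ

/-- **An abelian variety whose endomorphism algebra is a totally real field `F` with `3[F:ℚ] = dim A` has real
`𝔰𝔭₆`-block data** (characters = the embeddings `F → ℂ` through `embCharacter`; blocks internal by the tree's
`isInternal_iInf_eigenspace_embCharacter`, of dimension six by `finrank_eigenBlock_hodgeCharacter_eq_six`) — the hypothesis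
of Ribet 1983 Thm. 1 with `d/e = 3`: such an `A` satisfies `B•(Aⁿ) = D•(Aⁿ)` and the Hodge conjecture for all powers
(`HasRealSp6Blocks.hodgeConjectureFor_powSucc`).
[cite: Ribet1983, Thm. 1] [cite: Gordon1997, Thm. 6.3 (arXiv:alg-geom/9709030 p. 18)] [cite: Hazama1983, §3 (pp. 305–306)] -/
theorem hasRealSp6Blocks_of_isTotallyReal_of_three_mul_finrank_eq (A : AbelianVariety ℂ) (hF : IsField A.endAlgebra)
    [IsTotallyReal (EndField A hF)] (hdeg : 3 * Module.finrank ℚ A.endAlgebra = A.dim) : HasRealSp6Blocks A := by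
  classical
  have hHD : exists_isReal_hodgeModel := exists_isReal_hodgeModel_holds
  have hI : hodgePQ_independent_of_hodgeModel := hodgePQ_independent_of_hodgeModel_holds
  exact ⟨hF.mul_comm, EndField A hF →+* ℂ, inferInstance, inferInstance, embCharacter hF, embCharacter_isReal hF,
    isInternal_iInf_eigenspace_embCharacter hF hHD hI, finrank_iInf_eigenspace_embCharacter_eq_six hF hHD hI hdeg⟩

/-- **Isogeny closure of the instance**: `A'` isogenous to such an `A` carries real `𝔰𝔭₆`-block data
(`End⁰(A') ≅ End⁰(A)`, `dim A' = dim A`). [cite: Milne1986AbelianVarieties, §12 p. 122] [cite: Ribet1983, Thm. 1] -/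
theorem hasRealSp6Blocks_of_isIsogenous_of_isTotallyReal_of_three_mul_finrank_eq {A A' : AbelianVariety ℂ}
    (h : A'.IsIsogenous A) (hF : IsField A.endAlgebra) [IsTotallyReal (EndField A hF)]
    (hdeg : 3 * Module.finrank ℚ A.endAlgebra = A.dim) : HasRealSp6Blocks A' := by
  have hF' : IsField A'.endAlgebra := h.isField_endAlgebra_iff.2 hF
  obtain ⟨e⟩ := h.nonempty_endAlgebra_algEquiv
  haveI : IsTotallyReal (EndField A' hF') :=
    IsTotallyReal.ofRingEquiv (F := EndField A hF)
      (((EndField.toEndAlgebra hF).trans e.symm.toRingEquiv).trans (EndField.toEndAlgebra hF').symm)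
  exact hasRealSp6Blocks_of_isTotallyReal_of_three_mul_finrank_eq A' hF'
    (by rw [h.finrank_endAlgebra_eq, hdeg, AbelianVariety.dim_eq_of_isIsogenous_holds h])

end RealMultiplication

/-! ### §3 Orthogonal products -/

section Products

variable {A B : AbelianVariety ℂ}

/-- **Real `𝔰𝔭₆`-block data is stable under orthogonal products** (Moonen–Zarhin Thm. (3.2)(1) = Hazama 1989 for
this class: `X₁ × X₂` again satisfies (D) when `Hom(X₁, X₂) = 0`): the characters of `End⁰(A × B)` are the
`τ ∘ corner_i`, their blocks the `pr_i^* V_τ` (`HOneOfProductEndomorphismBlocks`), of the same dimension six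
(verbatim the tree's `HasRealSp4Blocks.prod`). [cite: MoonenZarhin1999LowDim, §3 Thm. (3.2)(1)]
[cite: Hazama1989, Thm. (= Gordon 7.6.2)] [cite: Hazama1983, §3 (pp. 305–306)] -/
theorem HasRealSp6Blocks.prod (hA : HasRealSp6Blocks A) (hB : HasRealSp6Blocks B) (hAB : ∀ f : A ⟶ B, f = 0)
    (hBA : ∀ g : B ⟶ A, g = 0) : HasRealSp6Blocks (A.prod B) := by
  classical
  obtain ⟨hcA, ι₁, _, _, τ₁, hreal₁, hint₁, h6₁⟩ := hA
  obtain ⟨hcB, ι₂, _, _, τ₂, hreal₂, hint₂, h6₂⟩ := hB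
  have hHD : exists_isReal_hodgeModel := exists_isReal_hodgeModel_holds
  have hI : hodgePQ_independent_of_hodgeModel := hodgePQ_independent_of_hodgeModel_holds
  have hc := endAlgebra_prod_comm_of_orthogonal hcA hcB hAB hBA
  -- the blocks of the product characters are the transported blocks
  have hblk₁ : ∀ i, (⨅ e : (A.prod B).endAlgebra, Module.End.eigenspace
      ((MulOpposite.unop (bettiRep (A.prod B) e)).baseChange ℂ)
        (((τ₁ i).comp (HOneProduct.fstAlgRingHom A B hc)) e) : Submodule ℂ _) =
      (⨅ e : A.endAlgebra, Module.End.eigenspace ((MulOpposite.unop (bettiRep A e)).baseChange ℂ) (τ₁ i e) :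
        Submodule ℂ _).map ((HOneProduct.pullFst A B).baseChange ℂ) := by
    intro i
    rw [← eigenBlock_comp_endAlgebraAlgEquivEndAlgOfComm_symm hc hHD hI]
    exact HOneProduct.eigenBlock_prodFstCharacter hHD hI hc (τ₁ i)
  have hblk₂ : ∀ j, (⨅ e : (A.prod B).endAlgebra, Module.End.eigenspace
      ((MulOpposite.unop (bettiRep (A.prod B) e)).baseChange ℂ)
        (((τ₂ j).comp (HOneProduct.sndAlgRingHom A B hc)) e) : Submodule ℂ _) =
      (⨅ e : B.endAlgebra, Module.End.eigenspace ((MulOpposite.unop (bettiRep B e)).baseChange ℂ) (τ₂ j e) :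
        Submodule ℂ _).map ((HOneProduct.pullSnd A B).baseChange ℂ) := by
    intro j
    rw [← eigenBlock_comp_endAlgebraAlgEquivEndAlgOfComm_symm hc hHD hI]
    exact HOneProduct.eigenBlock_prodSndCharacter hHD hI hc (τ₂ j)
  -- the family of characters
  let τ : ι₁ ⊕ ι₂ → ((A.prod B).endAlgebra →+* ℂ) :=
    Sum.elim (fun i => (τ₁ i).comp (HOneProduct.fstAlgRingHom A B hc))
      (fun j => (τ₂ j).comp (HOneProduct.sndAlgRingHom A B hc))
  have hτl : ∀ i, τ (Sum.inl i) = (τ₁ i).comp (HOneProduct.fstAlgRingHom A B hc) := fun i => rfl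
  have hτr : ∀ j, τ (Sum.inr j) = (τ₂ j).comp (HOneProduct.sndAlgRingHom A B hc) := fun j => rfl
  have hfun : (fun k => (⨅ e : (A.prod B).endAlgebra, Module.End.eigenspace
      ((MulOpposite.unop (bettiRep (A.prod B) e)).baseChange ℂ) (τ k e) : Submodule ℂ _)) =
      Sum.elim
        (fun i => (⨅ e : A.endAlgebra,
          Module.End.eigenspace ((MulOpposite.unop (bettiRep A e)).baseChange ℂ) (τ₁ i e) : Submodule ℂ _).map
            ((HOneProduct.pullFst A B).baseChange ℂ))
        (fun j => (⨅ e : B.endAlgebra,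
          Module.End.eigenspace ((MulOpposite.unop (bettiRep B e)).baseChange ℂ) (τ₂ j e) : Submodule ℂ _).map
            ((HOneProduct.pullSnd A B).baseChange ℂ)) := by
    funext k
    cases k with
    | inl i => rw [Sum.elim_inl, hτl, hblk₁]
    | inr j => rw [Sum.elim_inr, hτr, hblk₂]
  refine ⟨hc, ι₁ ⊕ ι₂, inferInstance, inferInstance, τ, ?_, ?_, ?_⟩
  · rintro (i | j)
    · rw [hτl, ← RingHom.comp_assoc, hreal₁ i]
    · rw [hτr, ← RingHom.comp_assoc, hreal₂ j]
  · rw [hfun]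
    exact HOneProduct.isInternal_sum_elim_map ((HOneProduct.pullFst A B).baseChange ℂ)
      ((HOneProduct.pullSnd A B).baseChange ℂ) ((HOneProduct.pullInl A B).baseChange ℂ)
      ((HOneProduct.pullInr A B).baseChange ℂ) HOneProduct.pullInl_pullFst_baseChange
      HOneProduct.pullInl_pullSnd_baseChange HOneProduct.pullInr_pullSnd_baseChange
      HOneProduct.pullInr_pullFst_baseChange HOneProduct.pullFst_pullInl_add_baseChange hint₁ hint₂
  · rintro (i | j)
    · rw [hτl, hblk₁, ← h6₁ i]
      exact (Submodule.equivMapOfInjective _ HOneProduct.pullFst_baseChange_injective _).finrank_eq.symm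
    · rw [hτr, hblk₂, ← h6₂ j]
      exact (Submodule.equivMapOfInjective _ HOneProduct.pullSnd_baseChange_injective _).finrank_eq.symm

/-- **Three pairwise orthogonal factors** (any number by iteration). [cite: MoonenZarhin1999LowDim, §3 Thm. (3.2)(1)] -/
theorem HasRealSp6Blocks.prod₃ {A₁ A₂ A₃ : AbelianVariety ℂ} (h₁ : HasRealSp6Blocks A₁) (h₂ : HasRealSp6Blocks A₂)
    (h₃ : HasRealSp6Blocks A₃) (h₁₂ : ∀ f : A₁ ⟶ A₂, f = 0) (h₂₁ : ∀ f : A₂ ⟶ A₁, f = 0)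
    (h₁₃ : ∀ f : A₁ ⟶ A₃, f = 0) (h₃₁ : ∀ f : A₃ ⟶ A₁, f = 0) (h₂₃ : ∀ f : A₂ ⟶ A₃, f = 0)
    (h₃₂ : ∀ f : A₃ ⟶ A₂, f = 0) : HasRealSp6Blocks ((A₁.prod A₂).prod A₃) :=
  (h₁.prod h₂ h₁₂ h₂₁).prod h₃ (hom_prod_eq_zero_of_orthogonal h₁₃ h₂₃)
    (hom_to_prod_eq_zero_of_orthogonal h₃₁ h₃₂)

/-- **Condition (D) for `A × B`** («`X₁ × X₂` again satisfies (D)»). [cite: MoonenZarhin1999LowDim, §3 Thm. (3.2)(1)]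
[cite: Hazama1989, Thm. (= Gordon 7.6.2)] -/
theorem HasRealSp6Blocks.isStablyNondegenerate_prod (hA : HasRealSp6Blocks A) (hB : HasRealSp6Blocks B)
    (hAB : ∀ f : A ⟶ B, f = 0) (hBA : ∀ g : B ⟶ A, g = 0) : IsStablyNondegenerate (A.prod B) :=
  (hA.prod hB hAB hBA).isStablyNondegenerate

/-- **`B = D` for every `B'` with slots over `A × B`** (in particular every `(A × B)^{N+1}`).
[cite: MoonenZarhin1999LowDim, §3 Thm. (3.2)(1)] [cite: Ribet1983, Thm. 1] -/
theorem HasRealSp6Blocks.isDivisorGenerated_of_avSlots_prod (hA : HasRealSp6Blocks A) (hB : HasRealSp6Blocks B)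
    (hAB : ∀ f : A ⟶ B, f = 0) (hBA : ∀ g : B ⟶ A, g = 0) {B' : AbelianVariety ℂ} {n : ℕ}
    {g : Fin n → (B' ⟶ A.prod B)} (hg : AVSlots (A.prod B) B' g) : IsDivisorGenerated B' :=
  (hA.prod hB hAB hBA).isDivisorGenerated_of_avSlots hg

/-- **The Hodge conjecture for every `(A × B)^{N+1}`**, unconditionally. [cite: MoonenZarhin1999LowDim, §3 Thm. (3.2)(1)]
[cite: Hazama1989, Thm. (= Gordon 7.6.2)] -/
theorem HasRealSp6Blocks.hodgeConjectureFor_prod_powSucc (hA : HasRealSp6Blocks A) (hB : HasRealSp6Blocks B)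
    (hAB : ∀ f : A ⟶ B, f = 0) (hBA : ∀ g : B ⟶ A, g = 0) (N : ℕ) :
    HodgeConjectureFor (((A.prod B).powSucc N)).dim ((A.prod B).powSucc N).X :=
  (hA.prod hB hAB hBA).hodgeConjectureFor_powSucc N

/-- **`B = D` for every mixed power `A^{M+1} × B^{N+1}`** (a retract of `(A × B)^{max+1}`, `MixedPowersRetract`).
[cite: MoonenZarhin1999LowDim, §3 Thm. (3.2)(1)] [cite: vanGeemen1994HodgeAV, §2.4–2.5 (p. 235) and §3.6–3.7 (p. 236)] -/
theorem HasRealSp6Blocks.isDivisorGenerated_powSucc_prod_powSucc (hA : HasRealSp6Blocks A)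
    (hB : HasRealSp6Blocks B) (hAB : ∀ f : A ⟶ B, f = 0) (hBA : ∀ g : B ⟶ A, g = 0) (M N : ℕ) :
    IsDivisorGenerated ((A.powSucc M).prod (B.powSucc N)) :=
  IsDivisorGenerated.powSucc_prod_powSucc_of_forall_prod_powSucc
    (hA.prod hB hAB hBA).isDivisorGenerated_powSucc M N

/-- **Condition (D) for every mixed power `A^{M+1} × B^{N+1}`** (it has slots over `A × B` up to the retract:
`(A^{M+1} × B^{N+1})^{K+1}` is again a mixed power up to isomorphism — here through `IsStablyNondegenerate.of_isIsogenous`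
and the tree's `StablyNondegenerateProducts`: every power of `A × B` is divisorial and `A^{M+1} × B^{N+1}`-powers are
retracts of powers of `A × B`). For two ORTHOGONAL relative-dimension-three real-multiplication varieties this is the
conclusion of the named fact `Hazama1989_stablyNondegenerate_prod`, now a theorem. [cite: MoonenZarhin1999LowDim, §3 Thm. (3.2)(1)]
[cite: Hazama1989, Thm. (= Gordon 7.6.2)] -/
theorem HasRealSp6Blocks.hodgeConjectureFor_powSucc_prod_powSucc (hA : HasRealSp6Blocks A)
    (hB : HasRealSp6Blocks B) (hAB : ∀ f : A ⟶ B, f = 0) (hBA : ∀ g : B ⟶ A, g = 0) (M N : ℕ) :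
    HodgeConjectureFor ((A.powSucc M).prod (B.powSucc N)).dim ((A.powSucc M).prod (B.powSucc N)).X :=
  hodgeConjectureFor_of_isDivisorGenerated _ (hA.isDivisorGenerated_powSucc_prod_powSucc hB hAB hBA M N)

/-- The Hodge conjecture for everything isogenous to some `A^{M+1} × B^{N+1}`. [cite: vanGeemen1994HodgeAV, Lemma 3.7]
[cite: MoonenZarhin1999LowDim, §3 Thm. (3.2)(1)] -/
theorem HasRealSp6Blocks.hodgeConjectureFor_of_isIsogenous_powSucc_prod_powSucc (hA : HasRealSp6Blocks A)
    (hB : HasRealSp6Blocks B) (hAB : ∀ f : A ⟶ B, f = 0) (hBA : ∀ g : B ⟶ A, g = 0) {X : AbelianVariety ℂ}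
    {M N : ℕ} (hX : X.IsIsogenous ((A.powSucc M).prod (B.powSucc N))) : HodgeConjectureFor X.dim X.X :=
  HodgeConjectureFor.of_isIsogenous hX (hA.hodgeConjectureFor_powSucc_prod_powSucc hB hAB hBA M N)

/-- **Two ORTHOGONAL real-multiplication varieties of relative dimension three — UNCONDITIONAL** (no Hazama binder):
`Hom(A, B) = 0 = Hom(B, A)` (e.g. `A`, `B` simple and non-isogenous), `End⁰(A) = F_A`, `End⁰(B) = F_B` totally real
fields with `3[F_A:ℚ] = dim A`, `3[F_B:ℚ] = dim B`: the Hodge conjecture for every `A^{M+1} × B^{N+1}`.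
[cite: MoonenZarhin1999LowDim, §3 Thm. (3.2)(1)] [cite: Hazama1989, Thm. (= Gordon 7.6.2)] [cite: Ribet1983, Thm. 1] -/
theorem hodgeConjectureFor_powSucc_prod_powSucc_of_relDimThree_of_orthogonal (A B : AbelianVariety ℂ)
    (hFA : IsField A.endAlgebra) [IsTotallyReal (EndField A hFA)] (hdegA : 3 * Module.finrank ℚ A.endAlgebra = A.dim)
    (hFB : IsField B.endAlgebra) [IsTotallyReal (EndField B hFB)] (hdegB : 3 * Module.finrank ℚ B.endAlgebra = B.dim)
    (hAB : ∀ f : A ⟶ B, f = 0) (hBA : ∀ g : B ⟶ A, g = 0) (M N : ℕ) :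
    HodgeConjectureFor ((A.powSucc M).prod (B.powSucc N)).dim ((A.powSucc M).prod (B.powSucc N)).X :=
  (hasRealSp6Blocks_of_isTotallyReal_of_three_mul_finrank_eq A hFA hdegA).hodgeConjectureFor_powSucc_prod_powSucc
    (hasRealSp6Blocks_of_isTotallyReal_of_three_mul_finrank_eq B hFB hdegB) hAB hBA M N

/-- **Condition (D) for `A × B`**, two orthogonal relative-dimension-three real-multiplication varieties — unconditional.
[cite: MoonenZarhin1999LowDim, §3 Thm. (3.2)(1)] [cite: Hazama1989, Thm. (= Gordon 7.6.2)] -/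
theorem isStablyNondegenerate_prod_of_relDimThree_of_orthogonal (A B : AbelianVariety ℂ)
    (hFA : IsField A.endAlgebra) [IsTotallyReal (EndField A hFA)] (hdegA : 3 * Module.finrank ℚ A.endAlgebra = A.dim)
    (hFB : IsField B.endAlgebra) [IsTotallyReal (EndField B hFB)] (hdegB : 3 * Module.finrank ℚ B.endAlgebra = B.dim)
    (hAB : ∀ f : A ⟶ B, f = 0) (hBA : ∀ g : B ⟶ A, g = 0) : IsStablyNondegenerate (A.prod B) :=
  (hasRealSp6Blocks_of_isTotallyReal_of_three_mul_finrank_eq A hFA hdegA).isStablyNondegenerate_prod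
    (hasRealSp6Blocks_of_isTotallyReal_of_three_mul_finrank_eq B hFB hdegB) hAB hBA


end Products

end Literature.AlgebraicGeometry.HodgeTheory

end
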